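import Literature.AnabelianGeometry.AbsoluteAnabelian.ProfiniteTerminology
import Mathlib.NumberTheory.Padics.RingHoms
import Mathlib.Topology.Instances.ZMod
import Mathlib.Topology.LocallyConstant.Basic
import Mathlib.LinearAlgebra.Dimension.Constructions
import Mathlib.LinearAlgebra.FiniteDimensional.Lemmas
import HarnessLib

/-!
# The free pro-`l` rank `δ¹_l` of a topologically finitely generated group is finite, and
# extensions of tfg profinite groups are tfg — tools for [AbsAnab] Lemma 1.1.4 (ii)

S. Mochizuki, *The Absolute Anabelian Geometry of Hyperbolic Curves* (2004) [AbsAnab], Lemma 1.1.4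
(ii) p. 7–8 computes with the integers `dim_{ℚ_l}((Π′)^{ab} ⊗ ℚ_l)`; the tree types them as
`freeProlRank` (`ProfiniteTerminology.lean`, [AbsTopI] Thm 2.6 "`δ¹_l`", "defined whenever finite")
valued in `ℕ∞`.  For the printed subtractions to be meaningful in `ℕ∞` one needs FINITENESS,
which print takes for granted for topologically finitely generated groups; this proof-only file
supplies it:

* `freeProlRank_le_card`: if a finite set `s` generates a dense subgroup of `G`, then
  `δ¹_l(G) ≤ #s` (a continuous surjection `G ↠ ℤ_l^n` reduces mod `l` to a surjection onto
  `𝔽_l^n`, which is then spanned by the `#s` images); `freeProlRank_ne_top_of_tfg`;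
* `freeProlRank_le_of_surjective`: `δ¹_l` does not increase under continuous surjections;
* `IsTopologicallyFinitelyGenerated.of_extension`: for a continuous surjection `Π ↠ G` of
  compact groups with topologically finitely generated kernel and `G`, `Π` is topologically
  finitely generated.

Proof-only (no definitions). [AbsTopI] §0 p. 8 "topologically finitely generated".
-/

noncomputable section

namespace Literature.AnabelianGeometry.AbsoluteAnabelian

universe u v

section Rank

variable {G : Type u} [Group G] [TopologicalSpace G]

/-- `δ¹_l` does not increase along a continuous surjective homomorphism `G ↠ H`: compose.
[cite: MochizukiAbsTopI2012, Thm 2.6 p.21] -/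
theorem freeProlRank_le_of_surjective {H : Type v} [Group H] [TopologicalSpace H]
    (f : G →ₜ* H) (hf : Function.Surjective f) (l : ℕ) [Fact l.Prime] :
    freeProlRank H l ≤ freeProlRank G l := by
  unfold freeProlRank
  refine iSup₂_le fun n hn => ?_
  obtain ⟨g, hg⟩ := hn
  exact le_iSup₂_of_le n ⟨g.comp f, hg.comp hf⟩ le_rfl

/-- Reduction modulo `l`, `ℤ_l → 𝔽_l`, is continuous (its fibres are open balls). [folklore] -/
private theorem continuous_toZMod (l : ℕ) [Fact l.Prime] :
    Continuous (PadicInt.toZMod : ℤ_[l] → ZMod l) := by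
  refine ((IsLocallyConstant.iff_isOpen_fiber).mpr fun c => ?_).continuous
  rw [isOpen_iff_mem_nhds]
  intro x hx
  have hx' : PadicInt.toZMod x = c := hx
  refine Filter.mem_of_superset (Metric.ball_mem_nhds x one_pos) fun y hy => ?_
  change PadicInt.toZMod y ∈ ({c} : Set (ZMod l))
  rw [Set.mem_singleton_iff, ← hx', ← sub_eq_zero, ← map_sub, ← RingHom.mem_ker,
    PadicInt.ker_toZMod, IsLocalRing.mem_maximalIdeal, PadicInt.mem_nonunits, ← dist_eq_norm]
  exact hy

/-- If a finite set `s ⊆ G` generates a dense subgroup and `g : G ↠ 𝔽_l^n` is a continuous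
surjective homomorphism onto the discrete group `𝔽_l^n`, then `n ≤ #s`: the `𝔽_l`-span of
`g(s)` is closed, contains `g` of the dense subgroup, hence is everything. [folklore] -/
private theorem rank_le_card_of_surjective [IsTopologicalGroup G] (s : Finset G)
    (hs : (Subgroup.closure (s : Set G)).topologicalClosure = ⊤) {l n : ℕ} [Fact l.Prime]
    (g : G →* Multiplicative (Fin n → ZMod l)) (hgc : Continuous g)
    (hgs : Function.Surjective g) : n ≤ s.card := by
  classical
  -- the `𝔽_l`-span `V` of the images of `s`
  set T : Finset (Fin n → ZMod l) := s.image (fun x => Multiplicative.toAdd (g x)) with hT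
  set V : Submodule (ZMod l) (Fin n → ZMod l) := Submodule.span (ZMod l) (T : Set _) with hVdef
  -- `g` maps the dense subgroup generated by `s` into `V`, hence everything into `V`
  have hW : Subgroup.closure (s : Set G) ≤
      (AddSubgroup.toSubgroup V.toAddSubgroup).comap g := by
    rw [Subgroup.closure_le]
    intro x hx
    change Multiplicative.toAdd (g x) ∈ V
    exact Submodule.subset_span (Finset.mem_coe.mpr (Finset.mem_image_of_mem _ hx))
  have hall : ∀ x : G, Multiplicative.toAdd (g x) ∈ V := by
    intro x
    have hx : x ∈ (Subgroup.closure (s : Set G)).topologicalClosure := by rw [hs]; trivial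
    have h1 : g x ∈ closure (g '' (Subgroup.closure (s : Set G) : Set G)) :=
      image_closure_subset_closure_image hgc ⟨x, hx, rfl⟩
    rw [(isClosed_discrete _).closure_eq] at h1
    obtain ⟨y, hy, hyx⟩ := h1
    rw [← hyx]
    exact hW hy
  have hV : V = ⊤ := by
    rw [eq_top_iff]
    intro v _
    obtain ⟨x, hx⟩ := hgs (Multiplicative.ofAdd v)
    have := hall x
    rwa [hx] at this
  -- dimension count
  have h1 : Module.finrank (ZMod l) V ≤ T.card := by
    have := finrank_span_le_card (R := ZMod l) (T : Set (Fin n → ZMod l))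
    rwa [Finset.toFinset_coe] at this
  rw [hV, finrank_top, Module.finrank_fin_fun] at h1
  exact h1.trans Finset.card_image_le

/-- **Finiteness of `δ¹_l` for topologically finitely generated groups**: if a finite set `s ⊆ G`
generates a dense subgroup, then `δ¹_l(G) ≤ #s` — a continuous surjection `G ↠ ℤ_l^n` composed
with reduction mod `l` is a continuous surjection onto the discrete group `𝔽_l^n`, whose
`𝔽_l`-span of the images of `s` is then everything, so `n ≤ #s`.
[cite: MochizukiAbsTopI2012, §0 p.8] -/
theorem freeProlRank_le_card [IsTopologicalGroup G] (s : Finset G)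
    (hs : (Subgroup.closure (s : Set G)).topologicalClosure = ⊤) (l : ℕ) [Fact l.Prime] :
    freeProlRank G l ≤ s.card := by
  classical
  unfold freeProlRank
  refine iSup₂_le fun n hn => ?_
  obtain ⟨f, hf⟩ := hn
  -- reduction mod `l` on `ℤ_l^n`, as a continuous homomorphism to the discrete `𝔽_l^n`
  let π : Multiplicative (Fin n → ℤ_[l]) →* Multiplicative (Fin n → ZMod l) :=
    (((PadicInt.toZMod (p := l)).toAddMonoidHom).compLeft (Fin n)).toMultiplicative
  have hπc : Continuous π :=
    continuous_pi fun i => (continuous_toZMod l).comp (continuous_apply i)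
  have hπs : Function.Surjective π := fun y =>
    ⟨fun i => (ZMod.ringHom_surjective (PadicInt.toZMod (p := l)) (y i)).choose,
      funext fun i => (ZMod.ringHom_surjective (PadicInt.toZMod (p := l)) (y i)).choose_spec⟩
  obtain ⟨g, hgc, hgs⟩ : ∃ g : G →* Multiplicative (Fin n → ZMod l),
      Continuous g ∧ Function.Surjective g :=
    ⟨π.comp f.toMonoidHom, hπc.comp (map_continuous f), hπs.comp hf⟩
  exact_mod_cast rank_le_card_of_surjective s hs g hgc hgs

/-- `δ¹_l(G) < ∞` for a topologically finitely generated group `G`.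
[cite: MochizukiAbsTopI2012, Thm 2.6 p.21] -/
theorem freeProlRank_ne_top_of_tfg [IsTopologicalGroup G] (h : IsTopologicallyFinitelyGenerated G)
    (l : ℕ) [Fact l.Prime] : freeProlRank G l ≠ ⊤ := by
  obtain ⟨s, hs⟩ := h.exists_finset
  exact ne_top_of_le_ne_top (ENat.coe_ne_top s.card) (freeProlRank_le_card s hs l)

end Rank

section Extension

variable {P : Type u} [Group P] [TopologicalSpace P] [IsTopologicalGroup P] [CompactSpace P]
variable {Q : Type v} [Group Q] [TopologicalSpace Q] [IsTopologicalGroup Q] [T2Space Q]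

/-- **Extensions of tfg compact groups are tfg**: if `f : P ↠ Q` is a continuous surjective
homomorphism of a compact group onto a Hausdorff group, with topologically finitely generated
kernel and topologically finitely generated `Q`, then `P` is topologically finitely generated
(generators: those of the kernel together with lifts of those of `Q`; the closed subgroup `C` they
generate contains the kernel and maps onto a closed dense subgroup of `Q`, so `C = P`).
[cite: MochizukiAbsTopI2012, §0 p.8] -/
theorem IsTopologicallyFinitelyGenerated.of_extension (f : P →ₜ* Q) (hf : Function.Surjective f)
    (hK : IsTopologicallyFinitelyGenerated f.toMonoidHom.ker)
    (hQ : IsTopologicallyFinitelyGenerated Q) : IsTopologicallyFinitelyGenerated P := by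
  classical
  obtain ⟨t, ht⟩ := hK.exists_finset
  obtain ⟨u, hu⟩ := hQ.exists_finset
  choose lift hlift using hf
  let s : Finset P := t.image (fun x : f.toMonoidHom.ker => (x : P)) ∪ u.image lift
  refine ⟨⟨s, ?_⟩⟩
  set C : Subgroup P := (Subgroup.closure (s : Set P)).topologicalClosure with hC
  have hCc : IsClosed (C : Set P) := Subgroup.isClosed_topologicalClosure _
  -- (1) the kernel lies in `C`
  have hker : f.toMonoidHom.ker ≤ C := by
    intro k hk
    have h1 : (⟨k, hk⟩ : f.toMonoidHom.ker) ∈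
        ((Subgroup.closure (t : Set f.toMonoidHom.ker)).topologicalClosure :
          Set f.toMonoidHom.ker) := by
      rw [ht]; trivial
    rw [Subgroup.topologicalClosure_coe, closure_subtype, ← Subgroup.coe_subtype,
      ← Subgroup.coe_map, MonoidHom.map_closure] at h1
    have h2 : Subgroup.closure (f.toMonoidHom.ker.subtype '' (t : Set f.toMonoidHom.ker)) ≤
        Subgroup.closure (s : Set P) := by
      apply Subgroup.closure_mono
      rintro _ ⟨x, hx, rfl⟩
      exact Finset.mem_coe.mpr (Finset.mem_union_left _ (Finset.mem_image_of_mem _ hx))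
    rw [hC, ← SetLike.mem_coe, Subgroup.topologicalClosure_coe]
    exact closure_mono (fun y hy => h2 hy) h1
  -- (2) `f(C) = Q`: it is closed and contains the dense subgroup generated by `u`
  have hmap : C.map f.toMonoidHom = ⊤ := by
    have hcl : IsClosed ((C.map f.toMonoidHom : Subgroup Q) : Set Q) := by
      rw [Subgroup.coe_map]
      exact (hCc.isCompact.image (map_continuous f)).isClosed
    have hle : Subgroup.closure (u : Set Q) ≤ C.map f.toMonoidHom := by
      rw [Subgroup.closure_le]
      intro q hq
      refine ⟨lift q, ?_, hlift q⟩
      apply Subgroup.le_topologicalClosure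
      apply Subgroup.subset_closure
      exact Finset.mem_coe.mpr (Finset.mem_union_right _ (Finset.mem_image_of_mem _ hq))
    rw [eq_top_iff, ← hu]
    exact (Subgroup.closure (u : Set Q)).topologicalClosure_minimal hle hcl
  -- (3) hence `C = P`
  rw [eq_top_iff]
  intro x _
  have hx : f x ∈ C.map f.toMonoidHom := by rw [hmap]; trivial
  obtain ⟨c, hc, hcx⟩ := hx
  have hk : c⁻¹ * x ∈ f.toMonoidHom.ker := by
    rw [MonoidHom.mem_ker, map_mul, map_inv]
    change (f c)⁻¹ * f x = 1
    rw [← hcx]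
    exact inv_mul_cancel _
  have := C.mul_mem hc (hker hk)
  rwa [mul_inv_cancel_left] at this

end Extension

end Literature.AnabelianGeometry.AbsoluteAnabelian
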